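import Summits.BirchSwinnertonDyer.BirchSwinnertonDyer.Theorems.KolyvaginDepthDoorDepthTableRankTwo794a1TwistBSDQuotient
import HarnessLib

/-!
# Route `KolyvaginDepthDoor`, crux `KolyvaginDepthSupplyKN` (stmt-BirchSwinnertonDyer-22820) —
# DEPTH TABLE v15, the PREPRINT-FREE road for the row `794a1` at `(p, d_K) = (5, -23)`: W. ZHANG 2014 THM. 1.6 BY NAME
# (the `p`-part of BSD in analytic rank one for ANY conductor) in place of Burungale–Castella–Skinner 2025

Helper file of the lead prover of line `levelone` (kdd-p1 g19; `--supports stmt-BirchSwinnertonDyer-22820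
--as helper`); it closes nothing and BSD is NOT proved by it.

`KolyvaginDepthDoorDepthTableRankTwo794a1TwistBSDQuotient` reads the rank-one datum of this row through Burungale–Castella–Skinner 2025 Cor. 1.3.1. The cell's
literature desk books that corollary's proof chain with an unrefereed node and records W. Zhang, Camb. J. Math. 2 (2014) Thm. 1.6
(tree fact `WZhang2014_padicValRat_bsd_rank_one_ordinary`) as the preprint-free road («T-ZH14»). Zhang's Thm. 1.4 hypotheses hold
for the twist `T = 794a1^{(-23)}` (minimal model `T₀ = [1, 0, 1, -1334, -30036]`, `Δ(T₀) = -235080991732`, prime-power factorisation `2^2`, `23^6`, `397^1`):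
(1) `ρ̄_{T,5}` onto (`minTwist23_hasSurjectiveModNGaloisRep_5`); (4) `5` good ordinary; (2)–(3): `T` is NOT semistable
(additive at the primes of `d_K`), its multiplicative primes are EXACTLY `2` and `397` (`v = 2, 1`, both prime to `5`), so
`Ram(ρ̄_{T,5}) = {2, 397}` has two elements and the parity clause of (3) is vacuous — certified below from the integer
model (`minTwist23_spadeOne_5`: `5 ∤ v_ℓ(Δ_T)` at EVERY multiplicative `ℓ`, by the factorisation; `minTwist23_zhangThree_5`).

* `minTwist23_natCard_selmerGroup_eq_of_bsdQuotient_zhang` — **W. Zhang 2014 Thm. 1.6 + GZK ⟹ the datum**: `ord_{s=1} L(T,s) = 1` and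
  `ord_5(L'(T,1)/(Reg_T·Ω_T)) ≤ 0` ⟹ `#Sel_5(T/ℚ) = 5` (generic `natCard_selmerGroup_eq_of_rankOne_bsdQuotient_zhang`; the torsion
  term of Zhang's identity vanishes because `T[5]` is irreducible).
* `natCard_selmerGroup_quadraticTwist_neg23_eq_of_bsdQuotient_zhang`, `cruxBody_of_twistBSDQuotient_zhang` — transport and the
  crux clause at `794a1`, exactly as in the BCS file.

CONDITIONAL on the named print facts; per curve; nothing class-wide (the open stub (S♭) is untouched); BSD is NOT proved by it.

References: [WZhang2014] Thm. 1.6 (p. 199), Thm. 1.4 (p. 197); [Darmon2004] Thm. 3.22; [SilvermanAEC2009] VII.5.1, VIII.8, X.4.2.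
-/

set_option linter.dupNamespace false

noncomputable section

open scoped Classical NumberField

namespace Summit.BirchSwinnertonDyer.BirchSwinnertonDyer.Theorems.KolyvaginDepthDoor

open Literature.NumberTheory.EllipticCurves Literature.NumberTheory.EllipticCurves.ModularForms
  WeierstrassCurve NumberField IsDedekindDomain
open Summit.BirchSwinnertonDyer.BirchSwinnertonDyer.Theorems
open Summit.BirchSwinnertonDyer.BirchSwinnertonDyer.Rank2Observatory
open Summit.BirchSwinnertonDyer.BirchSwinnertonDyer.Rank1Residual
open Summit.BirchSwinnertonDyer.Rank1Residual.Additive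

namespace C794a1

/-- **Zhang's (2), in full strength, for `T`: `5 ∤ v_ℓ(Δ_T)` at EVERY multiplicative prime `ℓ`** — a multiplicative `ℓ` divides
`N_T ∣ Δ(T₀) = -235080991732`, whose prime-power exponents (`2^2`, `23^6`, `397^1`) are all prime to `5` (tree lemma `not_dvd_padicValInt_of_intModel`, the
exponents supplied from the factorisation). [cite: WZhang2014, Thm. 1.4 (2) (p. 197)] [cite: SilvermanAEC2009, VII.5.1, VIII.8] -/
theorem minTwist23_spadeOne_5 :
    haveI := minTwist23_isElliptic; haveI := minTwist23_isGloballyMinimal;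
    haveI := Fact.mk (by norm_num : Nat.Prime 5);
    ∀ (ℓ : ℕ) [Fact ℓ.Prime], ((⟨1, 0, 1, -1334, -30036⟩ : WeierstrassCurve ℤ).map (Int.castRingHom ℚ)).HasMultiplicativeReductionAtPrime ℓ →
      ¬ 5 ∣ padicValInt ℓ ((⟨1, 0, 1, -1334, -30036⟩ : WeierstrassCurve ℤ).map (Int.castRingHom ℚ)).minimalDiscriminantInt := by
  haveI := minTwist23_isElliptic
  haveI := minTwist23_isGloballyMinimal
  haveI := Fact.mk (by norm_num : Nat.Prime 5)
  have hΔ : (⟨1, 0, 1, -1334, -30036⟩ : WeierstrassCurve ℤ).Δ = (-235080991732) := by decide +kernel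
  refine not_dvd_padicValInt_of_intModel minTwist23_intModel 5 ?_
  rw [hΔ]
  exact (by
      intro q hqP hqd
      have hqd' : q ∣ (-235080991732 : ℤ).natAbs := Int.natCast_dvd.mp hqd
      have hn : ((-235080991732 : ℤ).natAbs) = 2 ^ 2 * (23 ^ 6 * (397 ^ 1)) := by norm_num
      rw [hn] at hqd'
      rcases (Nat.Prime.dvd_mul hqP).mp hqd' with h | h0
      · obtain rfl := (Nat.prime_dvd_prime_iff_eq hqP (by norm_num)).mp (hqP.dvd_of_dvd_pow h)
        exact ⟨2, by decide +kernel, by decide +kernel, by norm_num⟩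
      · rcases (Nat.Prime.dvd_mul hqP).mp h0 with h | h1
        · obtain rfl := (Nat.prime_dvd_prime_iff_eq hqP (by norm_num)).mp (hqP.dvd_of_dvd_pow h)
          exact ⟨6, by decide +kernel, by decide +kernel, by norm_num⟩
        · obtain rfl := (Nat.prime_dvd_prime_iff_eq hqP (by norm_num)).mp (hqP.dvd_of_dvd_pow h1)
          exact ⟨1, by decide +kernel, by decide +kernel, by norm_num⟩
      )

/-- **Zhang's (3) for `T`**: `T` has the two multiplicative primes `2` (`v = 2`) and `397` (`v = 1`), both in `Ram(ρ̄_{T,5})`, so the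
set `Ram` is not a singleton and the parity clause is vacuous; the existence clause is witnessed by `2`.
[cite: WZhang2014, Thm. 1.4 (3) (p. 197)] [cite: SilvermanAEC2009, VII.5 Prop. 5.1 (b)] -/
theorem minTwist23_zhangThree_5 :
    haveI := minTwist23_isElliptic; haveI := minTwist23_isGloballyMinimal;
    ¬ ((⟨1, 0, 1, -1334, -30036⟩ : WeierstrassCurve ℤ).map (Int.castRingHom ℚ)).IsSemistable ℤ →
      (∃ ℓ : ℕ, ∃ _ : Fact ℓ.Prime, ((⟨1, 0, 1, -1334, -30036⟩ : WeierstrassCurve ℤ).map (Int.castRingHom ℚ)).HasMultiplicativeReductionAtPrime ℓ ∧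
          ¬ 5 ∣ padicValInt ℓ ((⟨1, 0, 1, -1334, -30036⟩ : WeierstrassCurve ℤ).map (Int.castRingHom ℚ)).minimalDiscriminantInt) ∧
        (Set.ncard {ℓ : ℕ | ∃ _ : Fact ℓ.Prime, ((⟨1, 0, 1, -1334, -30036⟩ : WeierstrassCurve ℤ).map (Int.castRingHom ℚ)).HasMultiplicativeReductionAtPrime ℓ ∧
            ¬ 5 ∣ padicValInt ℓ ((⟨1, 0, 1, -1334, -30036⟩ : WeierstrassCurve ℤ).map (Int.castRingHom ℚ)).minimalDiscriminantInt} = 1 →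
          Even (Set.ncard {ℓ : ℕ | ∃ _ : Fact ℓ.Prime, ((⟨1, 0, 1, -1334, -30036⟩ : WeierstrassCurve ℤ).map (Int.castRingHom ℚ)).HasMultiplicativeReductionAtPrime ℓ})) := by
  haveI := minTwist23_isElliptic
  haveI := minTwist23_isGloballyMinimal
  haveI i1 := Fact.mk (by norm_num : Nat.Prime 2)
  haveI i2 := Fact.mk (by norm_num : Nat.Prime 397)
  haveI := Fact.mk (by norm_num : Nat.Prime 5)
  intro _
  have hm1 : ((⟨1, 0, 1, -1334, -30036⟩ : WeierstrassCurve ℤ).map (Int.castRingHom ℚ)).HasMultiplicativeReductionAtPrime 2 :=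
    IntModel.hasMultiplicativeReductionAtPrime_of_intModel minTwist23_intModel 2 (by decide +kernel) (by decide +kernel)
  have hm2 : ((⟨1, 0, 1, -1334, -30036⟩ : WeierstrassCurve ℤ).map (Int.castRingHom ℚ)).HasMultiplicativeReductionAtPrime 397 :=
    IntModel.hasMultiplicativeReductionAtPrime_of_intModel minTwist23_intModel 397 (by decide +kernel) (by decide +kernel)
  have hv1 : ¬ 5 ∣ padicValInt 2 ((⟨1, 0, 1, -1334, -30036⟩ : WeierstrassCurve ℤ).map (Int.castRingHom ℚ)).minimalDiscriminantInt := minTwist23_spadeOne_5 2 hm1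
  have hv2 : ¬ 5 ∣ padicValInt 397 ((⟨1, 0, 1, -1334, -30036⟩ : WeierstrassCurve ℤ).map (Int.castRingHom ℚ)).minimalDiscriminantInt := minTwist23_spadeOne_5 397 hm2
  refine ⟨⟨2, i1, hm1, hv1⟩, fun h1 => ?_⟩
  exfalso
  obtain ⟨a, ha⟩ := Set.ncard_eq_one.mp h1
  have e1 : (2 : ℕ) = a := by
    have : (2 : ℕ) ∈ ({a} : Set ℕ) := ha ▸ ⟨i1, hm1, hv1⟩
    simpa using this
  have e2 : (397 : ℕ) = a := by
    have : (397 : ℕ) ∈ ({a} : Set ℕ) := ha ▸ ⟨i2, hm2, hv2⟩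
    simpa using this
  omega

/-! ## The rank-one datum via W. Zhang 2014 Thm. 1.6 (preprint-free) -/

/-- **THE RANK-ONE DATUM OF THE `794a1` ROW AT `d_K = -23` VIA W. ZHANG 2014 THM. 1.6 + GZK (by name).** For `T = 794a1^{(-23)}`:
IF `ord_{s=1} L(T,s) = 1` and `ord_5(L'(T,1)/(Reg_T·Ω_T)) ≤ 0`, THEN `#Sel_5(T/ℚ) = 5` (generic
`natCard_selmerGroup_eq_of_rankOne_bsdQuotient_zhang` at the certificates: good ordinary `5`, `ρ̄_{T,5}` onto, Zhang's (2)–(3)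
`minTwist23_spadeOne_5` / `minTwist23_zhangThree_5`, Kodaira–Néron). CONDITIONAL on the two named facts; per curve; BSD is not proved
by it. [cite: WZhang2014, Thm. 1.6 (p. 199), Thm. 1.4 (p. 197)] [cite: Darmon2004, Thm. 3.22] [cite: SilvermanAEC2009, Thm. X.4.2] -/
theorem minTwist23_natCard_selmerGroup_eq_of_bsdQuotient_zhang
    (hWZ : WZhang2014_padicValRat_bsd_rank_one_ordinary) (hGZK : rank_eq_analyticRank_of_analyticRank_le_one)
    (hr : haveI := minTwist23_isElliptic;
      ((⟨1, 0, 1, -1334, -30036⟩ : WeierstrassCurve ℤ).map (Int.castRingHom ℚ)).analyticRank = 1)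
    (hval : haveI := minTwist23_isElliptic; haveI := minTwist23_isGloballyMinimal;
      ∀ q : ℚ, ((⟨1, 0, 1, -1334, -30036⟩ : WeierstrassCurve ℤ).map (Int.castRingHom ℚ)).leadingLCoeff /
          (((((⟨1, 0, 1, -1334, -30036⟩ : WeierstrassCurve ℤ).map (Int.castRingHom ℚ)).regulator : ℂ)) *
            ((((⟨1, 0, 1, -1334, -30036⟩ : WeierstrassCurve ℤ).map (Int.castRingHom ℚ)).realPeriodRat : ℂ))) = (q : ℂ) →
        padicValRat 5 q ≤ 0) :
    haveI := minTwist23_isElliptic;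
    Nat.card (((⟨1, 0, 1, -1334, -30036⟩ : WeierstrassCurve ℤ).map (Int.castRingHom ℚ)).selmerGroup (5 : ℕ)) = 5 := by
  haveI := minTwist23_isElliptic
  haveI := minTwist23_isGloballyMinimal
  haveI := Fact.mk (by norm_num : Nat.Prime 5)
  exact natCard_selmerGroup_eq_of_rankOne_bsdQuotient_zhang hWZ hGZK _ 5 (by norm_num)
    minTwist23_goodOrdinary_5.1 minTwist23_goodOrdinary_5.2 minTwist23_hasSurjectiveModNGaloisRep_5
    (fun ℓ _ hm _ => minTwist23_spadeOne_5 ℓ hm) minTwist23_zhangThree_5 minTwist23_kodairaNeron_5 hr hval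

/-- **The same datum on `E.quadraticTwist (-23)`** (`E = 794a1`), Zhang road, transported along `minTwist23_smul_eq`. CONDITIONAL on
W. Zhang 2014 Thm. 1.6 and GZK by name; per curve; BSD is not proved by it. [cite: WZhang2014, Thm. 1.6 (p. 199)] [cite: Darmon2004, Thm. 3.22] -/
theorem natCard_selmerGroup_quadraticTwist_neg23_eq_of_bsdQuotient_zhang
    (hWZ : WZhang2014_padicValRat_bsd_rank_one_ordinary) (hGZK : rank_eq_analyticRank_of_analyticRank_le_one)
    (hr : haveI := minTwist23_isElliptic;
      ((⟨1, 0, 1, -1334, -30036⟩ : WeierstrassCurve ℤ).map (Int.castRingHom ℚ)).analyticRank = 1)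
    (hval : haveI := minTwist23_isElliptic; haveI := minTwist23_isGloballyMinimal;
      ∀ q : ℚ, ((⟨1, 0, 1, -1334, -30036⟩ : WeierstrassCurve ℤ).map (Int.castRingHom ℚ)).leadingLCoeff /
          (((((⟨1, 0, 1, -1334, -30036⟩ : WeierstrassCurve ℤ).map (Int.castRingHom ℚ)).regulator : ℂ)) *
            ((((⟨1, 0, 1, -1334, -30036⟩ : WeierstrassCurve ℤ).map (Int.castRingHom ℚ)).realPeriodRat : ℂ))) = (q : ℂ) →
        padicValRat 5 q ≤ 0) :
    haveI := isElliptic_c794a1;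
    haveI := isGloballyMinimal_c794a1;
    Nat.card ((((⟨1, 0, 1, -3, 2⟩ : WeierstrassCurve ℤ).map (Int.castRingHom ℚ)).quadraticTwist ((-23) : ℚ)).selmerGroup (5 : ℕ)) = 5 := by
  haveI := isElliptic_c794a1
  haveI := isGloballyMinimal_c794a1
  rw [← natCard_selmerGroup_eq_of_variableChange ((5 : ℕ) : ℤ) minTwist23_smul_eq]
  exact minTwist23_natCard_selmerGroup_eq_of_bsdQuotient_zhang hWZ hGZK hr hval

/-- **THE CRUX `KolyvaginDepthSupplyKN` AT `794a1`, MODULO PRINT AND ONE BSD-QUOTIENT VALUATION — preprint-free road.** As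
`cruxBody_of_twistBSDQuotient` of the BCS file, with W. Zhang 2014 Thm. 1.6 in place of Burungale–Castella–Skinner 2025 Cor. 1.3.1.
CONDITIONAL on the named facts (Stein–Wuthrich 2013 Thm. 1.1, W. Zhang 2014 Lemma 8.4 (1) / Thm. 9.1; W. Zhang 2014 Thm. 1.6; GZK) and the two rank-one hypotheses; per curve (the open stub (S♭)
is untouched); BSD is not proved by it. [cite: SteinWuthrich2013, Thm. 1.1 (p. 1758)] [cite: WZhang2014, Lemma 8.4 (1) (p. 236), Thm. 9.1 (p. 240)] [cite: WZhang2014, Thm. 1.6 (p. 199)] [cite: Darmon2004, Thm. 3.22] -/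
theorem cruxBody_of_twistBSDQuotient_zhang
    (hSW : SteinWuthrich2013_sha_inf_torsionBy_eq_bot_of_two_le_rank)
    (h84 : Literature.NumberTheory.EllipticCurves.WZhang2014_lemma84_exists_minimal_kolyvaginClass_one_selmerCard)
    (hWZ : WZhang2014_padicValRat_bsd_rank_one_ordinary) (hGZK : rank_eq_analyticRank_of_analyticRank_le_one)
    (K : Type) [Field K] [NumberField K] (hK : IsImaginaryQuadratic K) (hD : NumberField.discr K = -23)
    (hr : haveI := minTwist23_isElliptic;
      ((⟨1, 0, 1, -1334, -30036⟩ : WeierstrassCurve ℤ).map (Int.castRingHom ℚ)).analyticRank = 1)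
    (hval : haveI := minTwist23_isElliptic; haveI := minTwist23_isGloballyMinimal;
      ∀ q : ℚ, ((⟨1, 0, 1, -1334, -30036⟩ : WeierstrassCurve ℤ).map (Int.castRingHom ℚ)).leadingLCoeff /
          (((((⟨1, 0, 1, -1334, -30036⟩ : WeierstrassCurve ℤ).map (Int.castRingHom ℚ)).regulator : ℂ)) *
            ((((⟨1, 0, 1, -1334, -30036⟩ : WeierstrassCurve ℤ).map (Int.castRingHom ℚ)).realPeriodRat : ℂ))) = (q : ℂ) →
        padicValRat 5 q ≤ 0) :
    haveI := isElliptic_c794a1;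
    haveI := isGloballyMinimal_c794a1;
    ∃ (p : ℕ) (hp : Fact p.Prime), 5 ≤ p ∧ ((⟨1, 0, 1, -3, 2⟩ : WeierstrassCurve ℤ).map (Int.castRingHom ℚ)).HasGoodReductionAtPrime p ∧
      ¬ (p : ℤ) ∣ ((⟨1, 0, 1, -3, 2⟩ : WeierstrassCurve ℤ).map (Int.castRingHom ℚ)).frobeniusTrace p ∧ (∀ n : ℕ, ((⟨1, 0, 1, -3, 2⟩ : WeierstrassCurve ℤ).map (Int.castRingHom ℚ)).HasSurjectiveModNGaloisRep (p ^ n : ℕ)) ∧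
      (∀ v : HeightOneSpectrum (𝓞 ℚ), ((⟨1, 0, 1, -3, 2⟩ : WeierstrassCurve ℤ).map (Int.castRingHom ℚ)).HasMultiplicativeReductionAt v →
        ¬ p ∣ ((⟨1, 0, 1, -3, 2⟩ : WeierstrassCurve ℤ).map (Int.castRingHom ℚ)).ordMinimalDiscriminant v) ∧
      ∃ (K : Type) (_ : Field K) (_ : NumberField K), IsImaginaryQuadratic K ∧
        NumberField.discr K ≠ -3 ∧ NumberField.discr K ≠ -4 ∧
        ∃ (_ : NeZero (((⟨1, 0, 1, -3, 2⟩ : WeierstrassCurve ℤ).map (Int.castRingHom ℚ)).conductorNorm ℤ)), SatisfiesHeegnerHypothesis (((⟨1, 0, 1, -3, 2⟩ : WeierstrassCurve ℤ).map (Int.castRingHom ℚ)).conductorNorm ℤ) K ∧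
        ∃ (Dt : ModularParametrizationData ((⟨1, 0, 1, -3, 2⟩ : WeierstrassCurve ℤ).map (Int.castRingHom ℚ)) (((⟨1, 0, 1, -3, 2⟩ : WeierstrassCurve ℤ).map (Int.castRingHom ℚ)).conductorNorm ℤ)) (β : ℤ) (ι : K →+* ℂ) (n₁ : ℕ)
          (d : KolyvaginHeegnerData Dt β ι n₁), Squarefree n₁ ∧
          (∀ q ∈ n₁.primeFactors, Zhang2014.IsKolyvaginPrime (((⟨1, 0, 1, -3, 2⟩ : WeierstrassCurve ℤ).map (Int.castRingHom ℚ)).conductorNorm ℤ) ((⟨1, 0, 1, -3, 2⟩ : WeierstrassCurve ℤ).map (Int.castRingHom ℚ)) K p q) ∧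
          d.kolyvaginClass hp.out 1 ≠ 0 ∧
          (n₁.primeFactors.card + 1 ≤ ((⟨1, 0, 1, -3, 2⟩ : WeierstrassCurve ℤ).map (Int.castRingHom ℚ)).mordellWeilRank ∨
            (n₁.primeFactors.card ≤ ((⟨1, 0, 1, -3, 2⟩ : WeierstrassCurve ℤ).map (Int.castRingHom ℚ)).mordellWeilRank ∧
              n₁.primeFactors.card + 1 ≤ (((⟨1, 0, 1, -3, 2⟩ : WeierstrassCurve ℤ).map (Int.castRingHom ℚ)).quadraticTwist (NumberField.discr K : ℚ)).mordellWeilRank)) := by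
  haveI := isElliptic_c794a1
  haveI := isGloballyMinimal_c794a1
  have h1 := natCard_selmerGroup_quadraticTwist_neg23_eq_of_bsdQuotient_zhang hWZ hGZK hr hval
  refine cruxBody_of_twistSelmer hSW h84 K hK hD ?_
  have hcast : (NumberField.discr K : ℚ) = ((-23) : ℚ) := by rw [hD]; norm_num
  rw [hcast, h1]

end C794a1

end Summit.BirchSwinnertonDyer.BirchSwinnertonDyer.Theorems.KolyvaginDepthDoor

end
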